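import Mathlib
import Summits.ValiantsHypothesis.ValiantsHypothesis.Theorems.LacunarySymmetroidMatrixDescartesRegimeWindows

/-!
# `MatrixDescartes` (stmt-ValiantsHypothesis-18050) — regime windows, TOOLKIT: half-lines and bounded windows in both
# monotonicity directions; the three-window bound `Z₊ ≤ 3m`

HONEST FRAMING.  Cell `pub-symmetroid`, seat `val-sym-mdr-p2` (gen 4); helper file `--supports` the crux
`Theses.LacunarySymmetroid.MatrixDescartes`.  Root-counting ENGINE corollaries of `RegimeWindows.posRoots_window_le`
(≤ `card ι` distinct zeros of `det F`, `F = ∑ₗ X^{dₗ} Sₗ` with real symmetric letters, in every scale window on which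
some positive weight makes `F/w` Loewner-monotone); nothing here bears on the crux in general, on `stub_twoSided`, on
`DoorA26` / `DoorA34`, or on `VP ≠ VNP`.

* `posRoots_Ici_le_of_mono` / `_of_anti`: `F/w` non-decreasing (resp. non-increasing) on `[x₁, ∞)` ⇒ at most `card ι`
  roots `t ≥ x₁`;
* `posRoots_Ioo_le_of_mono` / `_of_anti`: the same on `(0, x₁]` ⇒ at most `card ι` roots in `(0, x₁)`;
* `posRoots_Ico_le_of_mono` / `_of_anti`: the same on `[x₁, x₂]` ⇒ at most `card ι` roots in `[x₁, x₂)`;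
* `threeWindows_posRoots_le`: non-increasing on `(0,x₁]`, non-decreasing on `[x₁,x₂]`, non-increasing on `[x₂,∞)`
  (after three weights) ⇒ `Z₊ ≤ 3·card ι` — the window shape of a `(+)(−)(+)(−)` sign word; in general a union bound
  over `N` windows gives `Z₊ ≤ N·card ι` («`Z₊ ≤ m × #normalisable windows`»).
The non-increasing versions are the non-decreasing ones applied to `−F` (`RegimeWindows.pencil_neg`,
`roots_det_pencil_neg`).  [folklore] Mathlib + tree lemmas; axioms `propext`, `Classical.choice`, `Quot.sound`.
-/

-- layout Summits/ValiantsHypothesis/ValiantsHypothesis forces the duplicated namespace component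
set_option linter.dupNamespace false

namespace Summit.ValiantsHypothesis.ValiantsHypothesis.Theorems.LacunarySymmetroidMatrixDescartes

open Polynomial Matrix Finset
open scoped BigOperators

namespace RegimeWindows

variable {K : ℕ} {ι : Type*} [Fintype ι]

omit [Fintype ι] in
/-- Anti-monotonicity of `F/w` is monotonicity of `(−F)/w`. [folklore] -/
theorem anti_to_mono (d : Fin K → ℕ) (S : Fin K → Matrix ι ι ℝ) (w : ℝ → ℝ) (s t : ℝ)
    (h : (((w s)⁻¹ • ∑ l, (s ^ d l) • S l) - ((w t)⁻¹ • ∑ l, (t ^ d l) • S l)).PosSemidef) :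
    (((w t)⁻¹ • ∑ l, (t ^ d l) • (-S l)) - ((w s)⁻¹ • ∑ l, (s ^ d l) • (-S l))).PosSemidef := by
  rw [pencil_neg, pencil_neg, smul_neg, smul_neg, neg_sub_neg]
  exact h

end RegimeWindows

section Toolkit

variable {K : ℕ}

/-- **Right half-line, non-decreasing.**  `F/w` Loewner non-decreasing on `[x₁, ∞)` (`x₁ > 0`, `w > 0` there) ⇒ at
most `card ι` distinct roots `t ≥ x₁` of `det F`. [folklore] -/
theorem posRoots_Ici_le_of_mono (ι : Type) [Fintype ι] [DecidableEq ι] (d : Fin K → ℕ)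
    (S : Fin K → Matrix ι ι ℝ) (hS : ∀ l, (S l).IsSymm) (x₁ : ℝ) (hx₁ : 0 < x₁) (w : ℝ → ℝ)
    (hw : ∀ u, x₁ ≤ u → 0 < w u)
    (hmono : ∀ s t : ℝ, x₁ ≤ s → s ≤ t →
      (((w t)⁻¹ • ∑ l, (t ^ d l) • S l) - ((w s)⁻¹ • ∑ l, (s ^ d l) • S l)).PosSemidef) :
    ((Matrix.det (∑ l, ((Polynomial.X : Polynomial ℝ) ^ d l) • (S l).map Polynomial.C)
        ).roots.toFinset.filter (fun t => x₁ ≤ t)).card ≤ Fintype.card ι :=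
  RegimeWindows.posRoots_window_le ι d S hS w (Set.Ici x₁) Set.ordConnected_Ici
    (fun _ hu => hx₁.trans_le hu) (fun u hu => hw u hu) (fun s t hs _ hst => hmono s t hs hst)
    (fun u => max u x₁) (fun _ _ hab => max_le_max hab le_rfl) (fun u _ => le_max_right u x₁)
    (fun t => x₁ ≤ t) (fun _ ht => ht) (fun _ _ _ hts => lt_max_of_lt_left hts) (fun _ ht => max_eq_left ht)

/-- **Right half-line, non-increasing.** [folklore] -/
theorem posRoots_Ici_le_of_anti (ι : Type) [Fintype ι] [DecidableEq ι] (d : Fin K → ℕ)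
    (S : Fin K → Matrix ι ι ℝ) (hS : ∀ l, (S l).IsSymm) (x₁ : ℝ) (hx₁ : 0 < x₁) (w : ℝ → ℝ)
    (hw : ∀ u, x₁ ≤ u → 0 < w u)
    (hanti : ∀ s t : ℝ, x₁ ≤ s → s ≤ t →
      (((w s)⁻¹ • ∑ l, (s ^ d l) • S l) - ((w t)⁻¹ • ∑ l, (t ^ d l) • S l)).PosSemidef) :
    ((Matrix.det (∑ l, ((Polynomial.X : Polynomial ℝ) ^ d l) • (S l).map Polynomial.C)
        ).roots.toFinset.filter (fun t => x₁ ≤ t)).card ≤ Fintype.card ι := by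
  have h := posRoots_Ici_le_of_mono ι d (fun l => -S l) (fun l => (hS l).neg) x₁ hx₁ w hw
    (fun s t hs hst => RegimeWindows.anti_to_mono d S w s t (hanti s t hs hst))
  rwa [roots_det_pencil_neg d S] at h

/-- **Left window, non-decreasing.**  `F/w` Loewner non-decreasing on `(0, x₁]` ⇒ at most `card ι` distinct roots in
`(0, x₁)`. [folklore] -/
theorem posRoots_Ioo_le_of_mono (ι : Type) [Fintype ι] [DecidableEq ι] (d : Fin K → ℕ)
    (S : Fin K → Matrix ι ι ℝ) (hS : ∀ l, (S l).IsSymm) (x₁ : ℝ) (hx₁ : 0 < x₁) (w : ℝ → ℝ)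
    (hw : ∀ u, 0 < u → u ≤ x₁ → 0 < w u)
    (hmono : ∀ s t : ℝ, 0 < s → s ≤ t → t ≤ x₁ →
      (((w t)⁻¹ • ∑ l, (t ^ d l) • S l) - ((w s)⁻¹ • ∑ l, (s ^ d l) • S l)).PosSemidef) :
    ((Matrix.det (∑ l, ((Polynomial.X : Polynomial ℝ) ^ d l) • (S l).map Polynomial.C)
        ).roots.toFinset.filter (fun t => 0 < t ∧ t < x₁)).card ≤ Fintype.card ι :=
  RegimeWindows.posRoots_window_le ι d S hS w (Set.Ioc 0 x₁) Set.ordConnected_Ioc (fun _ hu => hu.1)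
    (fun u hu => hw u hu.1 hu.2) (fun s t hs ht hst => hmono s t hs.1 hst ht.2)
    (fun u => min u x₁) (fun _ _ hab => min_le_min hab le_rfl)
    (fun u hu => ⟨lt_min hu hx₁, min_le_right u x₁⟩) (fun t => 0 < t ∧ t < x₁)
    (fun _ ht => ⟨ht.1, ht.2.le⟩) (fun _ _ ht hts => lt_min hts ht.2) (fun _ ht => min_eq_left ht.2.le)

/-- **Left window, non-increasing.** [folklore] -/
theorem posRoots_Ioo_le_of_anti (ι : Type) [Fintype ι] [DecidableEq ι] (d : Fin K → ℕ)
    (S : Fin K → Matrix ι ι ℝ) (hS : ∀ l, (S l).IsSymm) (x₁ : ℝ) (hx₁ : 0 < x₁) (w : ℝ → ℝ)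
    (hw : ∀ u, 0 < u → u ≤ x₁ → 0 < w u)
    (hanti : ∀ s t : ℝ, 0 < s → s ≤ t → t ≤ x₁ →
      (((w s)⁻¹ • ∑ l, (s ^ d l) • S l) - ((w t)⁻¹ • ∑ l, (t ^ d l) • S l)).PosSemidef) :
    ((Matrix.det (∑ l, ((Polynomial.X : Polynomial ℝ) ^ d l) • (S l).map Polynomial.C)
        ).roots.toFinset.filter (fun t => 0 < t ∧ t < x₁)).card ≤ Fintype.card ι := by
  have h := posRoots_Ioo_le_of_mono ι d (fun l => -S l) (fun l => (hS l).neg) x₁ hx₁ w hw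
    (fun s t hs hst htx => RegimeWindows.anti_to_mono d S w s t (hanti s t hs hst htx))
  rwa [roots_det_pencil_neg d S] at h

/-- **Bounded window, non-decreasing.**  `F/w` Loewner non-decreasing on `[x₁, x₂]` (`0 < x₁ ≤ x₂`) ⇒ at most
`card ι` distinct roots in `[x₁, x₂)`. [folklore] -/
theorem posRoots_Ico_le_of_mono (ι : Type) [Fintype ι] [DecidableEq ι] (d : Fin K → ℕ)
    (S : Fin K → Matrix ι ι ℝ) (hS : ∀ l, (S l).IsSymm) (x₁ x₂ : ℝ) (hx₁ : 0 < x₁) (hx₁₂ : x₁ ≤ x₂)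
    (w : ℝ → ℝ) (hw : ∀ u, x₁ ≤ u → u ≤ x₂ → 0 < w u)
    (hmono : ∀ s t : ℝ, x₁ ≤ s → s ≤ t → t ≤ x₂ →
      (((w t)⁻¹ • ∑ l, (t ^ d l) • S l) - ((w s)⁻¹ • ∑ l, (s ^ d l) • S l)).PosSemidef) :
    ((Matrix.det (∑ l, ((Polynomial.X : Polynomial ℝ) ^ d l) • (S l).map Polynomial.C)
        ).roots.toFinset.filter (fun t => x₁ ≤ t ∧ t < x₂)).card ≤ Fintype.card ι :=
  RegimeWindows.posRoots_window_le ι d S hS w (Set.Icc x₁ x₂) Set.ordConnected_Icc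
    (fun _ hu => hx₁.trans_le hu.1) (fun u hu => hw u hu.1 hu.2) (fun s t hs ht hst => hmono s t hs.1 hst ht.2)
    (fun u => max x₁ (min u x₂)) (fun _ _ hab => max_le_max le_rfl (min_le_min hab le_rfl))
    (fun u _ => ⟨le_max_left _ _, max_le hx₁₂ (min_le_right u x₂)⟩) (fun t => x₁ ≤ t ∧ t < x₂)
    (fun _ ht => ⟨ht.1, ht.2.le⟩) (fun _ _ ht hts => lt_max_of_lt_right (lt_min hts ht.2))
    (fun _ ht => by rw [min_eq_left ht.2.le, max_eq_right ht.1])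

/-- **Bounded window, non-increasing.** [folklore] -/
theorem posRoots_Ico_le_of_anti (ι : Type) [Fintype ι] [DecidableEq ι] (d : Fin K → ℕ)
    (S : Fin K → Matrix ι ι ℝ) (hS : ∀ l, (S l).IsSymm) (x₁ x₂ : ℝ) (hx₁ : 0 < x₁) (hx₁₂ : x₁ ≤ x₂)
    (w : ℝ → ℝ) (hw : ∀ u, x₁ ≤ u → u ≤ x₂ → 0 < w u)
    (hanti : ∀ s t : ℝ, x₁ ≤ s → s ≤ t → t ≤ x₂ →
      (((w s)⁻¹ • ∑ l, (s ^ d l) • S l) - ((w t)⁻¹ • ∑ l, (t ^ d l) • S l)).PosSemidef) :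
    ((Matrix.det (∑ l, ((Polynomial.X : Polynomial ℝ) ^ d l) • (S l).map Polynomial.C)
        ).roots.toFinset.filter (fun t => x₁ ≤ t ∧ t < x₂)).card ≤ Fintype.card ι := by
  have h := posRoots_Ico_le_of_mono ι d (fun l => -S l) (fun l => (hS l).neg) x₁ x₂ hx₁ hx₁₂ w hw
    (fun s t hs hst htx => RegimeWindows.anti_to_mono d S w s t (hanti s t hs hst htx))
  rwa [roots_det_pencil_neg d S] at h

/-- **THREE REGIME WINDOWS ⇒ `Z₊ ≤ 3·card ι`.**  Scales `0 < x₁ ≤ x₂`; `F/w₁` non-increasing on `(0,x₁]`, `F/w₂`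
non-decreasing on `[x₁,x₂]`, `F/w₃` non-increasing on `[x₂,∞)` (the window shape of a `(+)(−)(+)(−)` sign word).  Then
`det F` has at most `3·card ι` distinct positive zeros. [folklore] -/
theorem threeWindows_posRoots_le (ι : Type) [Fintype ι] [DecidableEq ι] (d : Fin K → ℕ)
    (S : Fin K → Matrix ι ι ℝ) (hS : ∀ l, (S l).IsSymm) (x₁ x₂ : ℝ) (hx₁ : 0 < x₁) (hx₁₂ : x₁ ≤ x₂)
    (w₁ w₂ w₃ : ℝ → ℝ) (hw₁ : ∀ u, 0 < u → u ≤ x₁ → 0 < w₁ u) (hw₂ : ∀ u, x₁ ≤ u → u ≤ x₂ → 0 < w₂ u)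
    (hw₃ : ∀ u, x₂ ≤ u → 0 < w₃ u)
    (h₁ : ∀ s t : ℝ, 0 < s → s ≤ t → t ≤ x₁ →
      (((w₁ s)⁻¹ • ∑ l, (s ^ d l) • S l) - ((w₁ t)⁻¹ • ∑ l, (t ^ d l) • S l)).PosSemidef)
    (h₂ : ∀ s t : ℝ, x₁ ≤ s → s ≤ t → t ≤ x₂ →
      (((w₂ t)⁻¹ • ∑ l, (t ^ d l) • S l) - ((w₂ s)⁻¹ • ∑ l, (s ^ d l) • S l)).PosSemidef)
    (h₃ : ∀ s t : ℝ, x₂ ≤ s → s ≤ t →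
      (((w₃ s)⁻¹ • ∑ l, (s ^ d l) • S l) - ((w₃ t)⁻¹ • ∑ l, (t ^ d l) • S l)).PosSemidef) :
    ((Matrix.det (∑ l, ((Polynomial.X : Polynomial ℝ) ^ d l) • (S l).map Polynomial.C)
        ).roots.toFinset.filter (fun t => 0 < t)).card ≤ 3 * Fintype.card ι := by
  set P := Matrix.det (∑ l, ((Polynomial.X : Polynomial ℝ) ^ d l) • (S l).map Polynomial.C)
    with hPdef
  have hA : (P.roots.toFinset.filter (fun t => 0 < t ∧ t < x₁)).card ≤ Fintype.card ι :=
    posRoots_Ioo_le_of_anti ι d S hS x₁ hx₁ w₁ hw₁ h₁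
  have hB : (P.roots.toFinset.filter (fun t => x₁ ≤ t ∧ t < x₂)).card ≤ Fintype.card ι :=
    posRoots_Ico_le_of_mono ι d S hS x₁ x₂ hx₁ hx₁₂ w₂ hw₂ h₂
  have hC : (P.roots.toFinset.filter (fun t => x₂ ≤ t)).card ≤ Fintype.card ι :=
    posRoots_Ici_le_of_anti ι d S hS x₂ (hx₁.trans_le hx₁₂) w₃ hw₃ h₃
  have hsub : P.roots.toFinset.filter (fun t => 0 < t)
      ⊆ (P.roots.toFinset.filter (fun t => 0 < t ∧ t < x₁)
          ∪ P.roots.toFinset.filter (fun t => x₁ ≤ t ∧ t < x₂))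
          ∪ P.roots.toFinset.filter (fun t => x₂ ≤ t) := by
    intro t ht
    rw [Finset.mem_filter] at ht
    rw [Finset.mem_union, Finset.mem_union, Finset.mem_filter, Finset.mem_filter, Finset.mem_filter]
    rcases lt_or_ge t x₁ with h1 | h1
    · exact Or.inl (Or.inl ⟨ht.1, ht.2, h1⟩)
    · rcases lt_or_ge t x₂ with h2 | h2
      · exact Or.inl (Or.inr ⟨ht.1, h1, h2⟩)
      · exact Or.inr ⟨ht.1, h2⟩
  calc (P.roots.toFinset.filter (fun t => 0 < t)).card
      ≤ ((P.roots.toFinset.filter (fun t => 0 < t ∧ t < x₁)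
          ∪ P.roots.toFinset.filter (fun t => x₁ ≤ t ∧ t < x₂))
          ∪ P.roots.toFinset.filter (fun t => x₂ ≤ t)).card := Finset.card_le_card hsub
    _ ≤ ((P.roots.toFinset.filter (fun t => 0 < t ∧ t < x₁)
          ∪ P.roots.toFinset.filter (fun t => x₁ ≤ t ∧ t < x₂))).card
          + (P.roots.toFinset.filter (fun t => x₂ ≤ t)).card := Finset.card_union_le _ _
    _ ≤ (P.roots.toFinset.filter (fun t => 0 < t ∧ t < x₁)).card
          + (P.roots.toFinset.filter (fun t => x₁ ≤ t ∧ t < x₂)).card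
          + (P.roots.toFinset.filter (fun t => x₂ ≤ t)).card := by
        have := Finset.card_union_le (P.roots.toFinset.filter (fun t => 0 < t ∧ t < x₁))
          (P.roots.toFinset.filter (fun t => x₁ ≤ t ∧ t < x₂))
        omega
    _ ≤ 3 * Fintype.card ι := by omega

end Toolkit

end Summit.ValiantsHypothesis.ValiantsHypothesis.Theorems.LacunarySymmetroidMatrixDescartes
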